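import Mathlib.Combinatorics.SimpleGraph.Clique
import Mathlib.LinearAlgebra.Matrix.PosDef
import Mathlib.Algebra.Order.Star.Real
import Mathlib.Algebra.Order.Archimedean.Real.Basic
import Mathlib.Tactic.FieldSimp
import Mathlib.Tactic.Linarith
import HarnessLib

/-!
# Lasserre's semidefinite hierarchy `las⁽ᵗ⁾(G)` for the stability number

The level-`t` Lasserre (moment / sum-of-squares) upper bound on the independence (stability)
number `α(G)` of a finite graph, in Laurent's normalisation (Laurent 2006, §3.1, program (22),
p. 248; Laurent 2003, §5):

  `las⁽ᵗ⁾(G) := max { Σ_{i ∈ V} y_i : M_t(y) ⪰ 0, y_∅ = 1, y_{ij} = 0 (ij ∈ E) }`,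

where `y = (y_I)` is indexed by subsets `I ⊆ V` and `M_t(y)` is the (combinatorial, truncated)
**moment matrix** indexed by `P_t(V) = {I ⊆ V : |I| ≤ t}` with entries `M_t(y)_{I,J} = y_{I ∪ J}`
(Laurent 2006, (18)). We also define the variant with the nonnegativity constraint `y ≥ 0`
added, which at level `1` is Schrijver's `ϑ′(G)` instead of Lovász's `ϑ(G)` (Laurent 2006, p. 248:
"For `k = 1`, `las⁽¹⁾(G) = ϑ(G)` … and the stronger bound obtained by adding nonnegativity to (22)
is `ϑ′(G)`"); it is the form used (inlined) by the route `PneNP/DelsarteLasserre` over the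
Hamming conflict graphs, where `ϑ′` is Delsarte's linear programming bound (Schrijver 1979).

## Main definitions

* `momentMatrix t y` — `M_t(y)`, the matrix `(y (I ∪ J))_{|I|,|J| ≤ t}`.
* `IsLasserreFeasible G t y` — `y ∅ = 1`, `y {u,v} = 0` on edges, `M_t(y) ⪰ 0` (program (22)).
* `IsNonnegLasserreFeasible G t y` — the same plus `y ≥ 0`.
* `lasserreStableBound G t = las⁽ᵗ⁾(G)` and `nonnegLasserreStableBound G t` — the real suprema
  of `Σ_v y_{v}` over the respective feasible sets.

## Main statements (all proved)

* `isNonnegLasserreFeasible_subsetIndicator`, `sum_subsetIndicator_singleton` — the 0/1 moment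
  vector `y_S = [S ⊆ C]` of an independent set `C` is feasible (with `y ≥ 0`) at every level,
  with value `|C|` (Laurent 2006, (17)–(20): `M_t(y) = x xᵀ`).
* `indepNum_le_lasserreStableBound` — soundness `α(G) ≤ las⁽ᵗ⁾(G)` for `1 ≤ t`
  (Laurent 2006, p. 248), and the same for the nonnegative variant.
* `lasserreStableBound_le_card` — `las⁽ᵗ⁾(G) ≤ |V|` (`0 ≤ y_v ≤ 1` from the `2 × 2` minors).
* `lasserreStableBound_anti` / `lasserreStableBound_anti_level` — antitone in the graph and in
  the level `t ≥ 1`; `nonnegLasserreStableBound_le_lasserreStableBound`.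
* `IsLasserreFeasible.apply_eq_zero_of_not_isIndepSet` — the edge constraints propagate through
  `M_t(y) ⪰ 0`: a feasible `y` vanishes on every non-stable `S` with `|S| ≤ 2t` (Laurent 2006,
  p. 248: "Under the assumption (17), the edge condition (19) is, in fact, equivalent to
  `y_{ij} = 0` (for `ij ∈ E`)").
* `IsLasserreFeasible.apply_le_apply_of_subset` — monotonicity `0 ≤ y_I ≤ y_J` for `J ⊆ I`,
  `|I| ≤ t` (Laurent 2006, (21) and the remark after (22)).

## Design notes

* `y : Finset V → ℝ` is a function on ALL subsets; only the values on `P_{2t}(V)` are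
  constrained, the others are irrelevant to the bound (this matches the inline form of the
  route `PneNP/DelsarteLasserre`, whose `Matrix.of fun I J : {S // S.card ≤ t} => y (I.1 ∪ J.1)`
  is `momentMatrix t y` by `rfl`, see `isNonnegLasserreFeasible_iff`).
* Level `t = 0` is DEGENERATE: `M_0(y) = (y_∅) = (1)` constrains nothing, the values `Σ_v y_v`
  are unbounded and the real supremum is the junk value `0`. All bound lemmas therefore carry
  `1 ≤ t`, as in the source ("For `k ≥ 1` …", Laurent 2006, p. 240).
* The supremum is a maximum (compact feasible set), which we do not prove; we prove it is a
  genuine supremum (nonempty, bounded by `|V|`) for `t ≥ 1`.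

Not here: the identification of level `1` with `Literature.Combinatorics.SimpleGraph.lovaszTheta`
(the trace-one formulation of `ϑ`) and finite convergence `las⁽ᵗ⁾(G) = α(G)` for `t ≥ α(G)`
(Laurent 2003) — both are separate files; Laurent's `las⁽ᵗ⁾₊` (constraints (21) on all of
`P_{2t}`), the Lovász–Schrijver `N₊` operator, block-diagonalisation for Hamming graphs.
Mathlib has `Matrix.PosSemidef`, `SimpleGraph.indepNum`, but no moment matrices or Lasserre
hierarchy (searched `moment matrix`, `Lasserre`, `theta`).

## References

* M. Laurent, *Strengthened semidefinite programming bounds for codes*, Math. Program. 109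
  (2007) 239–261, §3.1 (pp. 247–248), program (22) [Laurent2006].
* M. Laurent, *A comparison of the Sherali–Adams, Lovász–Schrijver, and Lasserre relaxations for
  0–1 programming*, Math. Oper. Res. 28 (2003) 470–496, §5 [Laurent2003] (cited after
  Laurent 2006, refs [7, 8], for `α(G) = las⁽ᵗ⁾(G)` when `t ≥ α(G)`; not re-read here).
* A. Schrijver, *A comparison of the Delsarte and Lovász bounds*, IEEE Trans. Inform. Theory 25
  (1979) 425–429 [Schrijver1979] (`ϑ′`).
-/

namespace Literature.Combinatorics.SimpleGraph

open Matrix Finset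

/-! ### Two-by-two minors of real positive semidefinite matrices -/

section PSD

variable {n : Type*} [Fintype n] [DecidableEq n]

/-- `e_iᵀ M e_j`-type evaluation: `(a e_i)ᵀ M (b e_j) = a M_{ij} b`. [folklore] -/
theorem single_dotProduct_mulVec_single (M : Matrix n n ℝ) (i j : n) (a b : ℝ) :
    Pi.single i a ⬝ᵥ (M *ᵥ Pi.single j b) = a * M i j * b := by
  rw [single_dotProduct, mulVec_single]
  simp [mul_assoc]

/-- The quadratic form of a real positive semidefinite matrix at `a e_i + b e_j` is
`a² M_{ii} + 2ab M_{ij} + b² M_{jj} ≥ 0`. [folklore] -/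
theorem psd_two_point_nonneg {M : Matrix n n ℝ} (hM : M.PosSemidef) (i j : n)
    (a b : ℝ) : 0 ≤ a * a * M i i + 2 * (a * M i j * b) + b * b * M j j := by
  have hsymm : M j i = M i j := by
    have h := hM.1.apply i j
    rwa [star_trivial] at h
  have h := hM.dotProduct_mulVec_nonneg (Pi.single i a + Pi.single j b)
  rw [star_trivial, mulVec_add, add_dotProduct, dotProduct_add, dotProduct_add,
    single_dotProduct_mulVec_single, single_dotProduct_mulVec_single,
    single_dotProduct_mulVec_single, single_dotProduct_mulVec_single, hsymm] at h
  linarith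

/-- In a real positive semidefinite matrix a zero diagonal entry kills its row and column:
`M_{jj} = 0 → M_{ij} = 0`. [folklore] -/
theorem psd_apply_eq_zero_of_diag_eq_zero {M : Matrix n n ℝ} (hM : M.PosSemidef)
    {j : n} (hj : M j j = 0) (i : n) : M i j = 0 := by
  by_contra hij
  have h := psd_two_point_nonneg hM i j 1 (-(M i i + 1) / (2 * M i j))
  rw [hj] at h
  have h2 : (1 : ℝ) * 1 * M i i + 2 * (1 * M i j * (-(M i i + 1) / (2 * M i j))) +
      -(M i i + 1) / (2 * M i j) * (-(M i i + 1) / (2 * M i j)) * 0 = -1 := by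
    field_simp
    ring
  linarith

/-- The `2 × 2` principal minors of a real positive semidefinite matrix are nonnegative:
`M_{ij}² ≤ M_{ii} M_{jj}`. [folklore] -/
theorem psd_sq_apply_le {M : Matrix n n ℝ} (hM : M.PosSemidef) (i j : n) :
    M i j ^ 2 ≤ M i i * M j j := by
  rcases eq_or_ne (M j j) 0 with hj | hj
  · rw [psd_apply_eq_zero_of_diag_eq_zero hM hj i, hj]
    simp
  · have hjpos : 0 < M j j := lt_of_le_of_ne hM.diag_nonneg (Ne.symm hj)
    have h := psd_two_point_nonneg hM i j (M j j) (-M i j)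
    have h2 : M j j * M j j * M i i + 2 * (M j j * M i j * -M i j) + -M i j * -M i j * M j j =
        M j j * (M i i * M j j - M i j ^ 2) := by ring
    rw [h2] at h
    nlinarith [(mul_nonneg_iff_of_pos_left hjpos).1 h]

end PSD

/-! ### Moment matrices and the two feasible regions -/

variable {V : Type*} [Fintype V] [DecidableEq V]

/-- Laurent's truncated **combinatorial moment matrix** `M_t(y)`: rows and columns indexed by
`P_t(V) = {I ⊆ V : |I| ≤ t}`, entry `(I, J) ↦ y_{I ∪ J}` (Laurent 2006, (18): "`Y_{I,J} = y_{I∪J}`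
(for `I, J ∈ P_k(V)`) … A matrix `Y` satisfying (18) is known as a moment matrix and is denoted
as `Y = M_k(y)`"). [cite: Laurent2006, §3.1 (18), p. 247] -/
def momentMatrix (t : ℕ) (y : Finset V → ℝ) :
    Matrix {S : Finset V // S.card ≤ t} {S : Finset V // S.card ≤ t} ℝ :=
  Matrix.of fun I J => y (I.1 ∪ J.1)

omit [Fintype V] in
/-- Entries of the moment matrix: `M_t(y)_{I,J} = y_{I ∪ J}`. [cite: Laurent2006, §3.1 (18), p. 247] -/
@[simp] theorem momentMatrix_apply (t : ℕ) (y : Finset V → ℝ) (I J : {S : Finset V // S.card ≤ t}) :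
    momentMatrix t y I J = y (I.1 ∪ J.1) := rfl

omit [Fintype V] in
/-- `momentMatrix t y` is literally the inline matrix used by route statements. [folklore] -/
theorem momentMatrix_eq_of (t : ℕ) (y : Finset V → ℝ) :
    momentMatrix t y = Matrix.of fun I J : {S : Finset V // S.card ≤ t} => y (I.1 ∪ J.1) := rfl

/-- **Feasibility for Lasserre's program (22)** at level `t` (Laurent 2006, p. 248:
"`las⁽ᵏ⁾(G) := max Σ_{i∈V} y_i s.t. M_k(y) ⪰ 0, y_∅ = 1, y_{ij} = 0 (ij ∈ E)`"): the moment
sequence `y` has `y_∅ = 1`, vanishes on the edges of `G`, and has positive semidefinite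
moment matrix `M_t(y)`. [cite: Laurent2006, §3.1 (22), p. 248] -/
structure IsLasserreFeasible (G : SimpleGraph V) (t : ℕ) (y : Finset V → ℝ) : Prop where
  /-- `y_∅ = 1` -/
  empty_eq_one : y ∅ = 1
  /-- the edge condition `y_{uv} = 0` for `uv ∈ E(G)` -/
  pair_eq_zero : ∀ ⦃u v : V⦄, G.Adj u v → y {u, v} = 0
  /-- `M_t(y) ⪰ 0` -/
  posSemidef : (momentMatrix t y).PosSemidef

/-- Feasibility for Lasserre's program (22) **with nonnegativity** `y ≥ 0` added (Laurent 2006,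
p. 248: "the stronger bound obtained by adding nonnegativity to (22) is `ϑ′(G)`" at `k = 1`;
McEliece–Rodemich–Rumsey–Welch, Schrijver 1979). Nonnegativity is imposed on all subsets; on
subsets of size `> 2t` this is harmless (those coordinates occur in no other constraint).
[cite: Laurent2006, §3.1, p. 248] -/
structure IsNonnegLasserreFeasible (G : SimpleGraph V) (t : ℕ) (y : Finset V → ℝ) : Prop
    extends IsLasserreFeasible G t y where
  /-- `y ≥ 0` -/
  nonneg : ∀ S, 0 ≤ y S

/-- **Lasserre's bound `las⁽ᵗ⁾(G)`** on the stability number (Laurent 2006, program (22),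
p. 248; Laurent 2003, §5): the supremum of `Σ_{v ∈ V} y_{v}` over `IsLasserreFeasible G t`.
A real supremum: for `t ≥ 1` the value set is nonempty and bounded by `|V|`
(`bddAbove_lasserreValues`), so this is a genuine supremum (a maximum by compactness, not
proved); for `t = 0` the values are unbounded and this is the junk value `0`.
[cite: Laurent2006, §3.1 (22), p. 248] -/
noncomputable def lasserreStableBound (G : SimpleGraph V) (t : ℕ) : ℝ :=
  sSup ((fun y : Finset V → ℝ => ∑ v, y {v}) '' {y | IsLasserreFeasible G t y})

/-- The nonnegative variant of Lasserre's bound: supremum of `Σ_v y_{v}` over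
`IsNonnegLasserreFeasible G t` (level `1` is Schrijver's `ϑ′(G)`, which for the Hamming
conflict graph `G(n,d)` is Delsarte's linear programming bound; Laurent 2006, pp. 241, 248;
Schrijver 1979). Same junk value `0` at `t = 0`. [cite: Laurent2006, §3.1, p. 248] -/
noncomputable def nonnegLasserreStableBound (G : SimpleGraph V) (t : ℕ) : ℝ :=
  sSup ((fun y : Finset V → ℝ => ∑ v, y {v}) '' {y | IsNonnegLasserreFeasible G t y})

/-- `las⁽ᵗ⁾(G)` as the supremum of the set of feasible values (set-builder form). [folklore] -/
theorem lasserreStableBound_eq_sSup (G : SimpleGraph V) (t : ℕ) :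
    lasserreStableBound G t = sSup {s | ∃ y, IsLasserreFeasible G t y ∧ s = ∑ v, y {v}} := by
  rw [lasserreStableBound]
  congr 1
  ext s
  simp only [Set.mem_image, Set.mem_setOf_eq, eq_comm]

/-- The nonnegative bound as the supremum of the set of feasible values (set-builder form).
[folklore] -/
theorem nonnegLasserreStableBound_eq_sSup (G : SimpleGraph V) (t : ℕ) :
    nonnegLasserreStableBound G t =
      sSup {s | ∃ y, IsNonnegLasserreFeasible G t y ∧ s = ∑ v, y {v}} := by
  rw [nonnegLasserreStableBound]
  congr 1
  ext s
  simp only [Set.mem_image, Set.mem_setOf_eq, eq_comm]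

omit [Fintype V] in
/-- Unfolding of `IsLasserreFeasible` into the inline conjunction used by route statements.
[folklore] -/
theorem isLasserreFeasible_iff (G : SimpleGraph V) (t : ℕ) (y : Finset V → ℝ) :
    IsLasserreFeasible G t y ↔ y ∅ = 1 ∧ (∀ u v : V, G.Adj u v → y {u, v} = 0) ∧
      (Matrix.of fun I J : {S : Finset V // S.card ≤ t} => y (I.1 ∪ J.1)).PosSemidef :=
  ⟨fun h => ⟨h.empty_eq_one, fun _ _ huv => h.pair_eq_zero huv, h.posSemidef⟩,
    fun h => ⟨h.1, fun _ _ huv => h.2.1 _ _ huv, h.2.2⟩⟩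

omit [Fintype V] in
/-- Unfolding of `IsNonnegLasserreFeasible` into the inline conjunction used by the route
`PneNP/DelsarteLasserre` (`y ∅ = 1 ∧ (∀ S, 0 ≤ y S) ∧ edges ∧ PSD`). [folklore] -/
theorem isNonnegLasserreFeasible_iff (G : SimpleGraph V) (t : ℕ) (y : Finset V → ℝ) :
    IsNonnegLasserreFeasible G t y ↔ y ∅ = 1 ∧ (∀ S, 0 ≤ y S) ∧
      (∀ u v : V, G.Adj u v → y {u, v} = 0) ∧
      (Matrix.of fun I J : {S : Finset V // S.card ≤ t} => y (I.1 ∪ J.1)).PosSemidef :=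
  ⟨fun h => ⟨h.empty_eq_one, h.nonneg, fun _ _ huv => h.pair_eq_zero huv, h.posSemidef⟩,
    fun h => ⟨⟨h.1, fun _ _ huv => h.2.2.1 _ _ huv, h.2.2.2⟩, h.2.1⟩⟩

omit [Fintype V] in
/-- The edge condition for a graph presented by a relation (`SimpleGraph.fromRel r`, adjacency
`u ≠ v ∧ (r u v ∨ r v u)`), in the one-sided form used by route statements over Hamming graphs.
[folklore] -/
theorem forall_fromRel_adj_pair_eq_zero_iff (r : V → V → Prop) (y : Finset V → ℝ) :
    (∀ u v : V, (SimpleGraph.fromRel r).Adj u v → y {u, v} = 0) ↔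
      ∀ u v : V, u ≠ v → r u v → y {u, v} = 0 := by
  refine ⟨fun h u v huv hr => h u v ((SimpleGraph.fromRel_adj _ _ _).2 ⟨huv, Or.inl hr⟩),
    fun h u v hadj => ?_⟩
  obtain ⟨hne, hr | hr⟩ := (SimpleGraph.fromRel_adj _ _ _).1 hadj
  · exact h u v hne hr
  · rw [pair_comm]
    exact h v u (Ne.symm hne) hr

/-! ### Consequences of `M_t(y) ⪰ 0` -/

namespace IsLasserreFeasible

variable {G : SimpleGraph V} {t : ℕ} {y : Finset V → ℝ}

omit [Fintype V] in
/-- Diagonal entries: `0 ≤ y_I` for `|I| ≤ t`. [cite: Laurent2006, §3.1 (21), p. 248] -/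
theorem apply_nonneg (hy : IsLasserreFeasible G t y) {I : Finset V} (hI : I.card ≤ t) :
    0 ≤ y I := by
  have h := hy.posSemidef.diag_nonneg (i := ⟨I, hI⟩)
  simpa using h

/-- Monotonicity along inclusion (Laurent 2006, (21) and p. 248: "the principal submatrix of
`M_k(y)` indexed by `{I, J}` has the form `(y_J y_I; y_I y_I)`, whose positive semidefiniteness
implies `0 ≤ y_I ≤ y_J`"): `J ⊆ I`, `|I| ≤ t` ⟹ `y_I ≤ y_J`. [cite: Laurent2006, §3.1 (21), p. 248] -/
theorem apply_le_apply_of_subset (hy : IsLasserreFeasible G t y) {I J : Finset V}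
    (hJI : J ⊆ I) (hI : I.card ≤ t) : y I ≤ y J := by
  have hJ : J.card ≤ t := (card_le_card hJI).trans hI
  have h := psd_sq_apply_le hy.posSemidef ⟨J, hJ⟩ ⟨I, hI⟩
  simp only [momentMatrix_apply, union_eq_right.2 hJI, union_self] at h
  have h0 : 0 ≤ y I := hy.apply_nonneg hI
  have h1 : 0 ≤ y J := hy.apply_nonneg hJ
  nlinarith

/-- `y_I ≤ y_∅ = 1` for `|I| ≤ t`. [cite: Laurent2006, §3.1 (21), p. 248] -/
theorem apply_le_one (hy : IsLasserreFeasible G t y) {I : Finset V} (hI : I.card ≤ t) :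
    y I ≤ 1 := by
  have h := hy.apply_le_apply_of_subset (empty_subset I) hI
  rwa [hy.empty_eq_one] at h

/-- The objective is at most the number of vertices: `Σ_v y_v ≤ |V|` (each `y_v ≤ 1`), for
`t ≥ 1`. [folklore] -/
theorem sum_singleton_le_card (hy : IsLasserreFeasible G t y) (ht : 1 ≤ t) :
    ∑ v, y {v} ≤ Fintype.card V := by
  calc ∑ v, y {v} ≤ ∑ _v : V, (1 : ℝ) :=
        sum_le_sum fun v _ => hy.apply_le_one (by rw [card_singleton]; exact ht)
    _ = Fintype.card V := by simp

/-- A zero entry propagates upwards inside `P_t`: `y_I = 0`, `I ⊆ K`, `|K| ≤ t` … more generally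
`y_{I ∪ J} = 0` for every `|J| ≤ t` (zero diagonal entry of `M_t(y)`). [folklore] -/
theorem apply_union_eq_zero (hy : IsLasserreFeasible G t y) {I J : Finset V} (hI : I.card ≤ t)
    (hJ : J.card ≤ t) (h0 : y I = 0) : y (I ∪ J) = 0 := by
  have hdiag : momentMatrix t y ⟨I, hI⟩ ⟨I, hI⟩ = 0 := by simpa using h0
  have h := psd_apply_eq_zero_of_diag_eq_zero hy.posSemidef hdiag ⟨J, hJ⟩
  simpa [union_comm] using h

/-- **The edge constraints propagate** (Laurent 2006, p. 248: "Under the assumption (17), the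
edge condition (19) [`y_{I∪J} = 0` if `I ∪ J` contains an edge] is, in fact, equivalent to
`y_{ij} = 0` (for `ij ∈ E`)"): a feasible `y` vanishes on every non-stable set of size `≤ 2t`.
[cite: Laurent2006, §3.1, p. 248] -/
theorem apply_eq_zero_of_not_isIndepSet (hy : IsLasserreFeasible G t y) {S : Finset V}
    (hS : S.card ≤ 2 * t) (hnot : ¬ G.IsIndepSet (S : Set V)) : y S = 0 := by
  -- extract an edge `uv` inside `S`
  simp only [SimpleGraph.IsIndepSet, Set.Pairwise, not_forall, not_not, exists_prop] at hnot
  obtain ⟨u, hu, v, hv, huv, hadj⟩ := hnot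
  rw [mem_coe] at hu hv
  have hP : ({u, v} : Finset V) ⊆ S := insert_subset_iff.2 ⟨hu, singleton_subset_iff.2 hv⟩
  have hPcard : ({u, v} : Finset V).card = 2 := card_pair huv
  have hyP : y {u, v} = 0 := hy.pair_eq_zero hadj
  have hScard : 2 ≤ S.card := hPcard ▸ card_le_card hP
  rcases Nat.lt_or_ge t 2 with ht | ht
  · -- `t ≤ 1`: then `S = {u, v}`
    have hSle : S.card ≤ 2 := by omega
    have hSeq : ({u, v} : Finset V) = S := eq_of_subset_of_card_le hP (by omega)
    rw [← hSeq, hyP]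
  · -- `t ≥ 2`: go through an intermediate `T`, `{u,v} ⊆ T ⊆ S`, `|T| = min t |S|`
    obtain ⟨T, hPT, hTS, hTcard⟩ :=
      exists_subsuperset_card_eq hP (n := min t S.card) (by rw [hPcard]; exact le_min ht hScard)
        (min_le_right _ _)
    have hTt : T.card ≤ t := hTcard ▸ min_le_left _ _
    -- first `y_T = 0`
    have hyT : y T = 0 := by
      have h := hy.apply_union_eq_zero (I := {u, v}) (J := T) (by rw [hPcard]; exact ht) hTt hyP
      rwa [union_eq_right.2 hPT] at h
    -- then `y_S = y_{T ∪ (S \ T)} = 0`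
    have hJ : (S \ T).card ≤ t := by
      rw [card_sdiff_of_subset hTS, hTcard]
      omega
    have h := hy.apply_union_eq_zero hTt hJ hyT
    rwa [union_sdiff_of_subset hTS] at h

/-! ### Monotonicity of the feasible regions -/

omit [Fintype V] in
/-- Fewer edges, fewer constraints. [folklore] -/
theorem anti {G G' : SimpleGraph V} (hGG' : G ≤ G') (hy : IsLasserreFeasible G' t y) :
    IsLasserreFeasible G t y :=
  ⟨hy.empty_eq_one, fun _ _ huv => hy.pair_eq_zero (hGG' huv), hy.posSemidef⟩

omit [Fintype V] in
/-- Lower level, fewer constraints: `M_t(y)` is a principal submatrix of `M_{t'}(y)` for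
`t ≤ t'`. [folklore] -/
theorem of_level_le {t' : ℕ} (htt' : t ≤ t') (hy : IsLasserreFeasible G t' y) :
    IsLasserreFeasible G t y := by
  refine ⟨hy.empty_eq_one, hy.pair_eq_zero, ?_⟩
  have h := hy.posSemidef.submatrix
    (fun I : {S : Finset V // S.card ≤ t} => (⟨I.1, I.2.trans htt'⟩ : {S : Finset V // S.card ≤ t'}))
  exact h

end IsLasserreFeasible

namespace IsNonnegLasserreFeasible

variable {G : SimpleGraph V} {t : ℕ} {y : Finset V → ℝ}

omit [Fintype V] in
/-- Fewer edges, fewer constraints. [folklore] -/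
theorem anti {G G' : SimpleGraph V} (hGG' : G ≤ G') (hy : IsNonnegLasserreFeasible G' t y) :
    IsNonnegLasserreFeasible G t y :=
  ⟨hy.toIsLasserreFeasible.anti hGG', hy.nonneg⟩

omit [Fintype V] in
/-- Lower level, fewer constraints. [folklore] -/
theorem of_level_le {t' : ℕ} (htt' : t ≤ t') (hy : IsNonnegLasserreFeasible G t' y) :
    IsNonnegLasserreFeasible G t y :=
  ⟨hy.toIsLasserreFeasible.of_level_le htt', hy.nonneg⟩

end IsNonnegLasserreFeasible

/-! ### Integer points: indicator vectors of stable sets -/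

/-- The 0/1 moment vector `y_S = [S ⊆ C]` of a set `C` of vertices. [folklore] -/
def subsetIndicator (C : Finset V) : Finset V → ℝ := fun S => if S ⊆ C then 1 else 0

omit [Fintype V] in
/-- Unfolding of `subsetIndicator`. [folklore] -/
@[simp] theorem subsetIndicator_apply (C S : Finset V) :
    subsetIndicator C S = if S ⊆ C then 1 else 0 := rfl

omit [Fintype V] in
/-- `M_t([· ⊆ C]) = x xᵀ` with `x_I = [I ⊆ C]` (Laurent 2006, (17)–(18): "Then `y` and the matrix
`Y := x xᵀ` satisfy …"). [cite: Laurent2006, §3.1 (17)-(18), p. 247] -/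
theorem momentMatrix_subsetIndicator (t : ℕ) (C : Finset V) :
    momentMatrix t (subsetIndicator C) =
      vecMulVec (fun I : {S : Finset V // S.card ≤ t} => if I.1 ⊆ C then (1 : ℝ) else 0)
        (fun I => if I.1 ⊆ C then (1 : ℝ) else 0) := by
  ext I J
  simp only [momentMatrix_apply, subsetIndicator_apply, vecMulVec_apply, union_subset_iff,
    mul_ite, mul_one, mul_zero]
  by_cases hI : I.1 ⊆ C <;> by_cases hJ : J.1 ⊆ C <;> simp [hI, hJ]

/-- **Integer feasibility** (Laurent 2006, (17)–(20)): the 0/1 moment vector of a stable set `C`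
is feasible, with nonnegativity, at every level. [cite: Laurent2006, §3.1 (17)-(20), p. 247] -/
theorem isNonnegLasserreFeasible_subsetIndicator {G : SimpleGraph V} (t : ℕ) {C : Finset V}
    (hC : G.IsIndepSet (C : Set V)) : IsNonnegLasserreFeasible G t (subsetIndicator C) := by
  refine ⟨⟨by simp, fun u v huv => ?_, ?_⟩, fun S => by simp only [subsetIndicator_apply]; split_ifs <;> norm_num⟩
  · simp only [subsetIndicator_apply, ite_eq_right_iff, one_ne_zero, imp_false]
    intro h
    have hu : u ∈ C := h (mem_insert_self u {v})
    have hv : v ∈ C := h (mem_insert_of_mem (mem_singleton_self v))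
    exact hC (mem_coe.2 hu) (mem_coe.2 hv) huv.ne huv
  · rw [momentMatrix_subsetIndicator]
    have h := posSemidef_vecMulVec_self_star
      (R := ℝ) (fun I : {S : Finset V // S.card ≤ t} => if I.1 ⊆ C then (1 : ℝ) else 0)
    rwa [star_trivial] at h

/-- The value of the 0/1 moment vector of `C` is `|C|`. [folklore] -/
theorem sum_subsetIndicator_singleton (C : Finset V) :
    ∑ v, subsetIndicator C {v} = C.card := by
  simp only [subsetIndicator_apply, singleton_subset_iff]
  rw [Finset.sum_boole, Finset.filter_mem_eq_inter, univ_inter]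

/-! ### The bounds: well-definedness, soundness, monotonicity -/

section Bounds

variable (G : SimpleGraph V) (t : ℕ)

/-- The feasible values are bounded above by `|V|` (for `t ≥ 1`). [folklore] -/
theorem bddAbove_lasserreValues (ht : 1 ≤ t) :
    BddAbove ((fun y : Finset V → ℝ => ∑ v, y {v}) '' {y | IsLasserreFeasible G t y}) := by
  refine ⟨Fintype.card V, ?_⟩
  rintro _ ⟨y, hy, rfl⟩
  exact hy.sum_singleton_le_card ht

/-- The nonnegative feasible values are bounded above by `|V|` (for `t ≥ 1`). [folklore] -/
theorem bddAbove_nonnegLasserreValues (ht : 1 ≤ t) :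
    BddAbove ((fun y : Finset V → ℝ => ∑ v, y {v}) '' {y | IsNonnegLasserreFeasible G t y}) :=
  (bddAbove_lasserreValues G t ht).mono (Set.image_mono fun _ hy => hy.toIsLasserreFeasible)

/-- The nonnegative feasible region is nonempty (it contains the moment vector of `∅`).
[folklore] -/
theorem nonnegLasserreValues_nonempty :
    ((fun y : Finset V → ℝ => ∑ v, y {v}) '' {y | IsNonnegLasserreFeasible G t y}).Nonempty :=
  ⟨_, ⟨subsetIndicator ∅, isNonnegLasserreFeasible_subsetIndicator t (by simp), rfl⟩⟩

/-- The feasible region is nonempty. [folklore] -/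
theorem lasserreValues_nonempty :
    ((fun y : Finset V → ℝ => ∑ v, y {v}) '' {y | IsLasserreFeasible G t y}).Nonempty :=
  (nonnegLasserreValues_nonempty G t).mono (Set.image_mono fun _ hy => hy.toIsLasserreFeasible)

variable {G t}

/-- Every feasible value is at most `las⁽ᵗ⁾(G)` (for `t ≥ 1`). [folklore] -/
theorem IsLasserreFeasible.sum_singleton_le_lasserreStableBound {y : Finset V → ℝ}
    (hy : IsLasserreFeasible G t y) (ht : 1 ≤ t) : ∑ v, y {v} ≤ lasserreStableBound G t :=
  le_csSup (bddAbove_lasserreValues G t ht) ⟨y, hy, rfl⟩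

/-- Every nonnegative feasible value is at most the nonnegative bound (for `t ≥ 1`).
[folklore] -/
theorem IsNonnegLasserreFeasible.sum_singleton_le_nonnegLasserreStableBound {y : Finset V → ℝ}
    (hy : IsNonnegLasserreFeasible G t y) (ht : 1 ≤ t) :
    ∑ v, y {v} ≤ nonnegLasserreStableBound G t :=
  le_csSup (bddAbove_nonnegLasserreValues G t ht) ⟨y, hy, rfl⟩

variable (G t)

/-- **Soundness** `α(G) ≤ las⁽ᵗ⁾(G)` for `t ≥ 1` (Laurent 2006, p. 248: "Then,
`α(G) ≤ las⁽ᵏ⁾(G)`"), via the 0/1 moment vector of a maximum stable set.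
[cite: Laurent2006, §3.1, p. 248] -/
theorem indepNum_le_lasserreStableBound (ht : 1 ≤ t) :
    (G.indepNum : ℝ) ≤ lasserreStableBound G t := by
  obtain ⟨C, hC⟩ := G.exists_isNIndepSet_indepNum
  rw [← hC.card_eq, ← sum_subsetIndicator_singleton]
  exact (isNonnegLasserreFeasible_subsetIndicator t hC.isIndepSet).toIsLasserreFeasible
    |>.sum_singleton_le_lasserreStableBound ht

/-- Soundness of the nonnegative variant: `α(G) ≤` `nonnegLasserreStableBound G t` for `t ≥ 1`.
[cite: Laurent2006, §3.1, p. 248] -/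
theorem indepNum_le_nonnegLasserreStableBound (ht : 1 ≤ t) :
    (G.indepNum : ℝ) ≤ nonnegLasserreStableBound G t := by
  obtain ⟨C, hC⟩ := G.exists_isNIndepSet_indepNum
  rw [← hC.card_eq, ← sum_subsetIndicator_singleton]
  exact (isNonnegLasserreFeasible_subsetIndicator t hC.isIndepSet)
    |>.sum_singleton_le_nonnegLasserreStableBound ht

/-- An independent set of size `s` gives `s ≤ las⁽ᵗ⁾(G)` (`t ≥ 1`). [cite: Laurent2006, §3.1, p. 248] -/
theorem le_lasserreStableBound_of_isNIndepSet {s : ℕ} {C : Finset V} (hC : G.IsNIndepSet s C)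
    (ht : 1 ≤ t) : (s : ℝ) ≤ lasserreStableBound G t := by
  rw [← hC.card_eq, ← sum_subsetIndicator_singleton]
  exact (isNonnegLasserreFeasible_subsetIndicator t hC.isIndepSet).toIsLasserreFeasible
    |>.sum_singleton_le_lasserreStableBound ht

/-- `las⁽ᵗ⁾(G) ≤ |V|`. [folklore] -/
theorem lasserreStableBound_le_card (ht : 1 ≤ t) :
    lasserreStableBound G t ≤ Fintype.card V :=
  csSup_le (lasserreValues_nonempty G t) (by rintro _ ⟨y, hy, rfl⟩; exact hy.sum_singleton_le_card ht)

/-- `0 ≤ las⁽ᵗ⁾(G)` for `t ≥ 1`. [folklore] -/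
theorem lasserreStableBound_nonneg (ht : 1 ≤ t) : 0 ≤ lasserreStableBound G t :=
  (Nat.cast_nonneg _).trans (indepNum_le_lasserreStableBound G t ht)

/-- Adding nonnegativity can only decrease the bound (`t ≥ 1`):
`nonnegLasserreStableBound G t ≤ lasserreStableBound G t` (Laurent 2006, p. 248:
`α(G) ≤ las₊⁽ᵏ⁾(G) ≤ las⁽ᵏ⁾(G)`). [cite: Laurent2006, §3.1, p. 248] -/
theorem nonnegLasserreStableBound_le_lasserreStableBound (ht : 1 ≤ t) :
    nonnegLasserreStableBound G t ≤ lasserreStableBound G t :=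
  csSup_le_csSup (bddAbove_lasserreValues G t ht) (nonnegLasserreValues_nonempty G t)
    (Set.image_mono fun _ hy => hy.toIsLasserreFeasible)

/-- `nonnegLasserreStableBound G t ≤ |V|`. [folklore] -/
theorem nonnegLasserreStableBound_le_card (ht : 1 ≤ t) :
    nonnegLasserreStableBound G t ≤ Fintype.card V :=
  (nonnegLasserreStableBound_le_lasserreStableBound G t ht).trans (lasserreStableBound_le_card G t ht)

variable {G t}

/-- **Antitone in the graph**: `G ≤ G' → las⁽ᵗ⁾(G') ≤ las⁽ᵗ⁾(G)` (more edges, more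
constraints), for `t ≥ 1`. [folklore] -/
theorem lasserreStableBound_anti {G G' : SimpleGraph V} (hGG' : G ≤ G') (ht : 1 ≤ t) :
    lasserreStableBound G' t ≤ lasserreStableBound G t :=
  csSup_le_csSup (bddAbove_lasserreValues G t ht) (lasserreValues_nonempty G' t)
    (Set.image_mono fun _ hy => IsLasserreFeasible.anti hGG' hy)

/-- Antitone in the graph, nonnegative variant. [folklore] -/
theorem nonnegLasserreStableBound_anti {G G' : SimpleGraph V} (hGG' : G ≤ G') (ht : 1 ≤ t) :
    nonnegLasserreStableBound G' t ≤ nonnegLasserreStableBound G t :=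
  csSup_le_csSup (bddAbove_nonnegLasserreValues G t ht) (nonnegLasserreValues_nonempty G' t)
    (Set.image_mono fun _ hy => IsNonnegLasserreFeasible.anti hGG' hy)

/-- **Antitone in the level** (a hierarchy): `1 ≤ t ≤ t' → las⁽ᵗ'⁾(G) ≤ las⁽ᵗ⁾(G)`
(Laurent 2006, p. 240: "a hierarchy of upper bounds for `α(G)`"). [cite: Laurent2006, §1, p. 240] -/
theorem lasserreStableBound_anti_level {t' : ℕ} (ht : 1 ≤ t) (htt' : t ≤ t') :
    lasserreStableBound G t' ≤ lasserreStableBound G t :=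
  csSup_le_csSup (bddAbove_lasserreValues G t ht) (lasserreValues_nonempty G t')
    (Set.image_mono fun _ hy => IsLasserreFeasible.of_level_le htt' hy)

/-- Antitone in the level, nonnegative variant. [cite: Laurent2006, §1, p. 240] -/
theorem nonnegLasserreStableBound_anti_level {t' : ℕ} (ht : 1 ≤ t) (htt' : t ≤ t') :
    nonnegLasserreStableBound G t' ≤ nonnegLasserreStableBound G t :=
  csSup_le_csSup (bddAbove_nonnegLasserreValues G t ht) (nonnegLasserreValues_nonempty G t')
    (Set.image_mono fun _ hy => IsNonnegLasserreFeasible.of_level_le htt' hy)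

/-- Upper bounds transfer: if every feasible `y` has `Σ_v y_v ≤ b` then `las⁽ᵗ⁾(G) ≤ b`
(the form in which exactness / inexactness statements are used). [folklore] -/
theorem lasserreStableBound_le_of_forall {b : ℝ}
    (h : ∀ y, IsLasserreFeasible G t y → ∑ v, y {v} ≤ b) : lasserreStableBound G t ≤ b :=
  csSup_le (lasserreValues_nonempty G t) (by rintro _ ⟨y, hy, rfl⟩; exact h y hy)

/-- Upper bounds transfer, nonnegative variant. [folklore] -/
theorem nonnegLasserreStableBound_le_of_forall {b : ℝ}
    (h : ∀ y, IsNonnegLasserreFeasible G t y → ∑ v, y {v} ≤ b) :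
    nonnegLasserreStableBound G t ≤ b :=
  csSup_le (nonnegLasserreValues_nonempty G t) (by rintro _ ⟨y, hy, rfl⟩; exact h y hy)

end Bounds

end Literature.Combinatorics.SimpleGraph
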